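import Summits.CriticalPhenomena.PercolationContinuityZ3.Theorems.Transplant.FKConnectivityAllQPat3ShapeThreeTab
import HarnessLib

/-!
# Connectivity correlation inequalities for `φ_{w,q}`, every `q > 0` — THREE-PIECE SHAPES: ORBIT-REPRESENTATIVE support-filtered
# certificate checking (`15³` cells instead of `25³`; census g40), and rows from the side table alone

Definitions + theorems file (`--supports stmt-CriticalPhenomena-4575`), census lineage (gen 40) of LANE 2's FK sub-programme; builds on
p205010 (kernel theorem, internal audit signed; external expert review pending).  No named facts, no sorries; standard axioms.

WHY: census g39's generator tables are symmetric (`g c P Q = g c Q P`, asserted by its `gen_pool`; orbit cells are symmetric by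
construction) and the target `symm8d coef` is symmetric in each pattern pair, so the rowwise domination is invariant under the
three swaps `(P_i, Q_i) ↦ (Q_i, P_i)`: it suffices to check the cells with `P_K ≤ Q_K`, `P_1 ≤ Q_1`, `P_2 ≤ Q_2` (`FK.Pat3.ix` order).
* `FK.Pat3.pairsLE` (15 pairs), `FK.Pat3.mem_pairsLE_or_swap`; `FK.symAt` (+ `_spec`), **`FK.prodsSym`**; `FK.Prod3.tensorF_swapK/1/2`;
* `FK.loop2R`, **`FK.rowR`** (unit of kernel evaluation: fixed `(P_K, Q_K)` and one `(P_1, Q_1)`), **`FK.loop1R`**, `FK.loop1R_of_rows`,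
  `FK.certCheckGR`, `FK.cell_of_loops`, and **`FK.certCheckGR_of_pairs`**: shift bound + `prodsSym` + the fifteen `loop1R` facts +
  target symmetric in each pair (and `≥ 0` beyond `B + 6`) ⇒ `m·Σ λ·tensor ≤ D·τ` at EVERY cell (generic `τ`, as census g36's
  `FK.certCheckG_of_pairs` in `…Pat3FastCheck.lean`, whose `cellLoopG`/`suppAt` filters are reused);
* `FK.symm8d_swapK/1/2`; **`FK.rows_of_tab3R`** (tabulated coefficient literal, `τ = symm8d (coefGet3 T)`) and **`FK.rows_of_side3R`**
  (NO coefficient literal: `τ = symm8d (coefSide3 |L| S F)` recomputed from the side table in each cell) — both deliver the rows of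
  `FK.shape3C_nonneg_of_rows`.
MEASURED (census g40, EEE-triangle × T_sym, 500 products): one `loop1G` pair ≈ 30 s of kernel time (25 per certificate), one `loop1R`
pair ≈ 15 s (15 per certificate) — with `set_option Elab.async false` (sequential kernel evaluations, census g36's memory rule).
[cite: AyyerLinussonRavichandran2025, §7 (p. 22)]
-/

namespace Summit.CriticalPhenomena.PercolationContinuityZ3.Theorems

namespace FK

open SimpleGraph Literature.Probability.LatticeModels Literature.Probability.Percolation
open scoped Classical

variable {V : Type*}

/-! ### Orbit-representative loops (census g40): with SYMMETRIC generator tables the filtered check need only visit the pattern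
pairs `P ≤ Q` of each piece (`15³` cells instead of `25³`), against a target symmetric in each pair (e.g. `symm8d coef`). -/

section RepLoop

/-- The fifteen pattern pairs `(P, Q)` with `P.ix ≤ Q.ix`. [folklore] -/
def Pat3.pairsLE : List (Pat3 × Pat3) :=
  [(Pat3.all, Pat3.all), (Pat3.all, Pat3.xy_s), (Pat3.all, Pat3.xs_y), (Pat3.all, Pat3.ys_x), (Pat3.all, Pat3.sep),
    (Pat3.xy_s, Pat3.xy_s), (Pat3.xy_s, Pat3.xs_y), (Pat3.xy_s, Pat3.ys_x), (Pat3.xy_s, Pat3.sep), (Pat3.xs_y, Pat3.xs_y),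
    (Pat3.xs_y, Pat3.ys_x), (Pat3.xs_y, Pat3.sep), (Pat3.ys_x, Pat3.ys_x), (Pat3.ys_x, Pat3.sep), (Pat3.sep, Pat3.sep)]

/-- Every ordered pair is a listed pair or the swap of one. [folklore] -/
theorem Pat3.mem_pairsLE_or_swap (P Q : Pat3) : (P, Q) ∈ Pat3.pairsLE ∨ (Q, P) ∈ Pat3.pairsLE := by
  cases P <;> cases Q <;> decide

/-- Symmetry test of a two-level generator at the two levels the tensors read. [folklore] -/
def symAt (g : ℕ → Pat3 → Pat3 → ℤ) : Bool :=
  Pat3.list.all fun P => Pat3.list.all fun Q => decide (g 0 P Q = g 0 Q P) && decide (g 1 P Q = g 1 Q P)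

/-- Unpacking a passed symmetry test. [folklore] -/
theorem symAt_spec {g : ℕ → Pat3 → Pat3 → ℤ} (h : symAt g = true) (c : ℕ) (hc : c < 2) (P Q : Pat3) : g c P Q = g c Q P := by
  unfold symAt at h
  simp only [List.all_eq_true, Bool.and_eq_true, decide_eq_true_eq] at h
  obtain ⟨h0, h1⟩ := h P P.mem_list Q Q.mem_list
  interval_cases c
  · exact h0
  · exact h1

/-- All three generators of every product are symmetric. [folklore] -/
def prodsSym (prods : List Prod3) : Bool :=
  prods.all fun p => symAt p.gK && symAt p.g1 && symAt p.g2

/-- The unrolled tensor is invariant under swapping a symmetric generator's pattern pair (piece K). [folklore] -/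
theorem Prod3.tensorF_swapK (p : Prod3) (hK : symAt p.gK = true) (d : ℕ) (PK QK P1 Q1 P2 Q2 : Pat3) :
    p.tensorF d QK PK P1 Q1 P2 Q2 = p.tensorF d PK QK P1 Q1 P2 Q2 := by
  unfold Prod3.tensorF
  rw [symAt_spec hK 0 (by omega) QK PK, symAt_spec hK 1 (by omega) QK PK]

/-- The unrolled tensor is invariant under swapping a symmetric generator's pattern pair (piece 1). [folklore] -/
theorem Prod3.tensorF_swap1 (p : Prod3) (h1 : symAt p.g1 = true) (d : ℕ) (PK QK P1 Q1 P2 Q2 : Pat3) :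
    p.tensorF d PK QK Q1 P1 P2 Q2 = p.tensorF d PK QK P1 Q1 P2 Q2 := by
  unfold Prod3.tensorF
  rw [symAt_spec h1 0 (by omega) Q1 P1, symAt_spec h1 1 (by omega) Q1 P1]

/-- The unrolled tensor is invariant under swapping a symmetric generator's pattern pair (piece 2). [folklore] -/
theorem Prod3.tensorF_swap2 (p : Prod3) (h2 : symAt p.g2 = true) (d : ℕ) (PK QK P1 Q1 P2 Q2 : Pat3) :
    p.tensorF d PK QK P1 Q1 Q2 P2 = p.tensorF d PK QK P1 Q1 P2 Q2 := by
  unfold Prod3.tensorF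
  rw [symAt_spec h2 0 (by omega) Q2 P2, symAt_spec h2 1 (by omega) Q2 P2]

/-- Representative loop over the third piece's pairs `P2 ≤ Q2` (filtered by the third generator's support). [folklore] -/
def loop2R (τ : ℕ → Pat3 → Pat3 → Pat3 → Pat3 → Pat3 → Pat3 → ℤ) (m D B : ℕ) (prods1 : List Prod3) (PK QK P1 Q1 : Pat3) : Bool :=
  Pat3.pairsLE.all fun pq =>
    cellLoopG m D B (fun d => τ d PK QK P1 Q1 pq.1 pq.2) (prods1.filter fun p => suppAt p.g2 pq.1 pq.2) PK QK P1 Q1 pq.1 pq.2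

/-- Representative ROW: fixed `(P_K, Q_K)` and one second-piece pair `(P_1, Q_1)` — the unit of kernel evaluation. [folklore] -/
def rowR (τ : ℕ → Pat3 → Pat3 → Pat3 → Pat3 → Pat3 → Pat3 → ℤ) (m D B : ℕ) (prodsK : List Prod3) (PK QK P1 Q1 : Pat3) : Bool :=
  loop2R τ m D B (prodsK.filter fun p => suppAt p.g1 P1 Q1) PK QK P1 Q1

/-- Representative loop over the second piece's pairs `P1 ≤ Q1`. [folklore] -/
def loop1R (τ : ℕ → Pat3 → Pat3 → Pat3 → Pat3 → Pat3 → Pat3 → ℤ) (m D B : ℕ) (prodsK : List Prod3) (PK QK : Pat3) : Bool :=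
  Pat3.pairsLE.all fun pq => rowR τ m D B prodsK PK QK pq.1 pq.2

/-- **Representative filtered check**: shift bound, generator symmetry, and the fifteen first-pair loops `PK ≤ QK`. [folklore] -/
def certCheckGR (τ : ℕ → Pat3 → Pat3 → Pat3 → Pat3 → Pat3 → Pat3 → ℤ) (m D B : ℕ) (prods : List Prod3) : Bool :=
  (prods.all fun p => decide (p.shift ≤ B)) && prodsSym prods &&
    Pat3.pairsLE.all fun pq => loop1R τ m D B (prods.filter fun p => suppAt p.gK pq.1 pq.2) pq.1 pq.2

/-- The cell inequality delivered by a passed cell loop, with the three support filters undone. [folklore] -/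
theorem cell_of_loops {τ : ℕ → Pat3 → Pat3 → Pat3 → Pat3 → Pat3 → Pat3 → ℤ} {m D B : ℕ} {prods : List Prod3}
    {PK QK P1 Q1 P2 Q2 : Pat3} {d : ℕ} (hd : d < B + 6)
    (h : cellLoopG m D B (fun d => τ d PK QK P1 Q1 P2 Q2)
      (((prods.filter fun p => suppAt p.gK PK QK).filter fun p => suppAt p.g1 P1 Q1).filter fun p => suppAt p.g2 P2 Q2)
      PK QK P1 Q1 P2 Q2 = true) :
    (m : ℤ) * (prods.map fun p => (p.lam : ℤ) * p.tensorF d PK QK P1 Q1 P2 Q2).sum ≤ D * τ d PK QK P1 Q1 P2 Q2 := by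
  unfold cellLoopG at h
  simp only [List.all_eq_true, decide_eq_true_eq] at h
  have h4 := h d (List.mem_range.2 hd)
  simp only [Prod3.tensorF_eq] at h4 ⊢
  rw [sum_map_filter_of_zero (fun p _ hq => by rw [p.tensor_eq_zero_2 (suppAt_false hq), mul_zero]),
    sum_map_filter_of_zero (fun p _ hq => by rw [p.tensor_eq_zero_1 (suppAt_false hq), mul_zero]),
    sum_map_filter_of_zero (fun p _ hq => by rw [p.tensor_eq_zero_K (suppAt_false hq), mul_zero])] at h4
  exact h4

/-- **Entrywise domination from the representative check** (target symmetric in each pattern pair, vanishing or nonnegative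
beyond `B + 6`): the fifteen `FK.loop1R` facts (each row provable by its own `decide +kernel`) give `m·Σ λ·tensor ≤ D·τ` at EVERY
level offset and cell. [folklore] -/
theorem certCheckGR_of_pairs {τ : ℕ → Pat3 → Pat3 → Pat3 → Pat3 → Pat3 → Pat3 → ℤ} (m D B : ℕ) {prods : List Prod3}
    (hshift : (prods.all fun p => decide (p.shift ≤ B)) = true) (hsym : prodsSym prods = true)
    (hpairs : ∀ pq ∈ Pat3.pairsLE, loop1R τ m D B (prods.filter fun p => suppAt p.gK pq.1 pq.2) pq.1 pq.2 = true)
    (hτK : ∀ d PK QK P1 Q1 P2 Q2, τ d QK PK P1 Q1 P2 Q2 = τ d PK QK P1 Q1 P2 Q2)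
    (hτ1 : ∀ d PK QK P1 Q1 P2 Q2, τ d PK QK Q1 P1 P2 Q2 = τ d PK QK P1 Q1 P2 Q2)
    (hτ2 : ∀ d PK QK P1 Q1 P2 Q2, τ d PK QK P1 Q1 Q2 P2 = τ d PK QK P1 Q1 P2 Q2)
    (hτ : ∀ d, B + 6 ≤ d → ∀ PK QK P1 Q1 P2 Q2 : Pat3, 0 ≤ τ d PK QK P1 Q1 P2 Q2) (d : ℕ) (PK QK P1 Q1 P2 Q2 : Pat3) :
    (m : ℤ) * (prods.map fun p => (p.lam : ℤ) * p.tensor d PK QK P1 Q1 P2 Q2).sum ≤ D * τ d PK QK P1 Q1 P2 Q2 := by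
  simp only [List.all_eq_true, decide_eq_true_eq] at hshift
  by_cases hd : d < B + 6
  · -- symmetry of the left-hand side under the three swaps
    unfold prodsSym at hsym
    simp only [List.all_eq_true, Bool.and_eq_true] at hsym
    have LK : ∀ A B C D' E F : Pat3, (prods.map fun p => (p.lam : ℤ) * p.tensor d B A C D' E F).sum =
        (prods.map fun p => (p.lam : ℤ) * p.tensor d A B C D' E F).sum := fun A B C D' E F =>
      congrArg List.sum (List.map_congr_left fun p hp => by
        rw [← Prod3.tensorF_eq, ← Prod3.tensorF_eq, p.tensorF_swapK (hsym p hp).1.1])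
    have L1 : ∀ A B C D' E F : Pat3, (prods.map fun p => (p.lam : ℤ) * p.tensor d A B D' C E F).sum =
        (prods.map fun p => (p.lam : ℤ) * p.tensor d A B C D' E F).sum := fun A B C D' E F =>
      congrArg List.sum (List.map_congr_left fun p hp => by
        rw [← Prod3.tensorF_eq, ← Prod3.tensorF_eq, p.tensorF_swap1 (hsym p hp).1.2])
    have L2 : ∀ A B C D' E F : Pat3, (prods.map fun p => (p.lam : ℤ) * p.tensor d A B C D' F E).sum =
        (prods.map fun p => (p.lam : ℤ) * p.tensor d A B C D' E F).sum := fun A B C D' E F =>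
      congrArg List.sum (List.map_congr_left fun p hp => by
        rw [← Prod3.tensorF_eq, ← Prod3.tensorF_eq, p.tensorF_swap2 (hsym p hp).2])
    -- reduce to the representative cell
    have main : ∀ A B C D' E F : Pat3, (A, B) ∈ Pat3.pairsLE → (C, D') ∈ Pat3.pairsLE → (E, F) ∈ Pat3.pairsLE →
        (m : ℤ) * (prods.map fun p => (p.lam : ℤ) * p.tensor d A B C D' E F).sum ≤ D * τ d A B C D' E F := by
      intro A B C D' E F hAB hCD hEF
      have h1 := hpairs (A, B) hAB
      unfold loop1R at h1
      simp only [List.all_eq_true] at h1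
      have h2 := h1 (C, D') hCD
      unfold rowR loop2R at h2
      simp only [List.all_eq_true] at h2
      have h3 := h2 (E, F) hEF
      have h4 := cell_of_loops hd h3
      simp only [Prod3.tensorF_eq] at h4
      exact h4
    rcases Pat3.mem_pairsLE_or_swap PK QK with hK | hK <;> rcases Pat3.mem_pairsLE_or_swap P1 Q1 with h1 | h1 <;>
      rcases Pat3.mem_pairsLE_or_swap P2 Q2 with h2 | h2
    · exact main _ _ _ _ _ _ hK h1 h2
    · rw [← L2, ← hτ2]; exact main _ _ _ _ _ _ hK h1 h2
    · rw [← L1, ← hτ1]; exact main _ _ _ _ _ _ hK h1 h2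
    · rw [← L1, ← hτ1, ← L2, ← hτ2]; exact main _ _ _ _ _ _ hK h1 h2
    · rw [← LK, ← hτK]; exact main _ _ _ _ _ _ hK h1 h2
    · rw [← LK, ← hτK, ← L2, ← hτ2]; exact main _ _ _ _ _ _ hK h1 h2
    · rw [← LK, ← hτK, ← L1, ← hτ1]; exact main _ _ _ _ _ _ hK h1 h2
    · rw [← LK, ← hτK, ← L1, ← hτ1, ← L2, ← hτ2]; exact main _ _ _ _ _ _ hK h1 h2
  · rw [not_lt] at hd
    have hz : (prods.map fun p => (p.lam : ℤ) * p.tensor d PK QK P1 Q1 P2 Q2).sum = 0 := by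
      refine List.sum_eq_zero fun x hx => ?_
      rw [List.mem_map] at hx
      obtain ⟨p, hp, rfl⟩ := hx
      rw [Prod3.tensor_eq_zero_of_le p (hshift p hp) hd, mul_zero]
    rw [hz, mul_zero]
    exact mul_nonneg (Nat.cast_nonneg _) (hτ d hd PK QK P1 Q1 P2 Q2)

/-- `symm8d coef` is symmetric in the first pair. [folklore] -/
theorem symm8d_swapK (coef : ℕ → Pat3 → Pat3 → Pat3 → Pat3 → Pat3 → Pat3 → ℤ) (d : ℕ) (PK QK P1 Q1 P2 Q2 : Pat3) :
    symm8d coef d QK PK P1 Q1 P2 Q2 = symm8d coef d PK QK P1 Q1 P2 Q2 := by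
  unfold symm8d; ring

/-- `symm8d coef` is symmetric in the second pair. [folklore] -/
theorem symm8d_swap1 (coef : ℕ → Pat3 → Pat3 → Pat3 → Pat3 → Pat3 → Pat3 → ℤ) (d : ℕ) (PK QK P1 Q1 P2 Q2 : Pat3) :
    symm8d coef d PK QK Q1 P1 P2 Q2 = symm8d coef d PK QK P1 Q1 P2 Q2 := by
  unfold symm8d; ring

/-- `symm8d coef` is symmetric in the third pair. [folklore] -/
theorem symm8d_swap2 (coef : ℕ → Pat3 → Pat3 → Pat3 → Pat3 → Pat3 → Pat3 → ℤ) (d : ℕ) (PK QK P1 Q1 P2 Q2 : Pat3) :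
    symm8d coef d PK QK P1 Q1 Q2 P2 = symm8d coef d PK QK P1 Q1 P2 Q2 := by
  unfold symm8d; ring

/-- A first-pair representative loop from its fifteen rows. [folklore] -/
theorem loop1R_of_rows {τ : ℕ → Pat3 → Pat3 → Pat3 → Pat3 → Pat3 → Pat3 → ℤ} {m D B : ℕ} {prodsK : List Prod3} {PK QK : Pat3}
    (h : ∀ pq ∈ Pat3.pairsLE, rowR τ m D B prodsK PK QK pq.1 pq.2 = true) : loop1R τ m D B prodsK PK QK = true := by
  unfold loop1R
  rw [List.all_eq_true]
  exact h

variable {ι : Type*} [DecidableEq ι] in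
/-- **Rows from the tabulated + representative filtered checks** (three pieces): as `FK.rows_of_tab3` with the fifteen
first-pair representative loops `FK.loop1R` (generator symmetry `FK.prodsSym` checked) in place of the 25 `FK.loop1G`. [folklore] -/
theorem rows_of_tab3R {L : List (ι × ι)} {iK jK kK i1 j1 k1 i2 j2 k2 ix iy is : ι} {F : ℕ → Pat3 → Pat3 → ℤ}
    {S : List (List (List (List (Pat3 × ℕ))))} {T : List (List (List (List (List (List (List ℤ))))))} {prods : List Prod3}
    {Dn B : ℕ} (hB : 2 * L.length + 2 ≤ B) (hS : sideCheck3 L iK jK kK i1 j1 k1 i2 j2 k2 ix iy is S = true)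
    (hT : coefCheck3 L.length S F T (B + 6) = true) (hlen : T.length ≤ B + 6)
    (hshift : (prods.all fun p => decide (p.shift ≤ B)) = true) (hsym : prodsSym prods = true)
    (hpairs : ∀ pq ∈ Pat3.pairsLE, loop1R (symm8d (coefGet3 T)) 8 Dn B (prods.filter fun p => suppAt p.gK pq.1 pq.2) pq.1 pq.2 = true)
    (d : ℕ) (PK QK P1 Q1 P2 Q2 : Pat3) :
    8 * (prods.map fun q => (q.lam : ℤ) * q.tensor d PK QK P1 Q1 P2 Q2).sum ≤
      (Dn : ℤ) * symm8d (coefTab3 L iK jK kK i1 j1 k1 i2 j2 k2 ix iy is F) d PK QK P1 Q1 P2 Q2 := by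
  have hz : ∀ d', B + 6 ≤ d' → ∀ A1 A2 A3 A4 A5 A6 : Pat3, coefGet3 T d' A1 A2 A3 A4 A5 A6 = 0 :=
    fun d' hd' _ _ _ _ _ _ => coefGet3_eq_zero (hlen.trans hd') _ _ _ _ _ _
  have key := certCheckGR_of_pairs 8 Dn B hshift hsym hpairs (symm8d_swapK _) (symm8d_swap1 _) (symm8d_swap2 _)
    (fun d' hd' A1 A2 A3 A4 A5 A6 => by simp only [symm8d, hz d' hd', add_zero, le_refl]) d PK QK P1 Q1 P2 Q2
  have e : symm8d (coefTab3 L iK jK kK i1 j1 k1 i2 j2 k2 ix iy is F) d PK QK P1 Q1 P2 Q2 = symm8d (coefGet3 T) d PK QK P1 Q1 P2 Q2 := by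
    by_cases hd : d < B + 6
    · simp only [symm8d, coefTab3_eq_coefSide3 hS, coefCheck3_spec hT hd]
    · rw [not_lt] at hd
      have hz' : ∀ A1 A2 A3 A4 A5 A6 : Pat3, coefTab3 L iK jK kK i1 j1 k1 i2 j2 k2 ix iy is F d A1 A2 A3 A4 A5 A6 = 0 :=
        fun _ _ _ _ _ _ => coefTab3_eq_zero L iK jK kK i1 j1 k1 i2 j2 k2 ix iy is F (by omega) _ _ _ _ _ _
      simp only [symm8d, hz', hz d hd, add_zero]
  rw [e]
  exact_mod_cast key

variable {ι : Type*} [DecidableEq ι] in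
/-- **Rows from the side table alone** (three pieces, no coefficient literal): side check + shift bound + generator symmetry +
the fifteen representative loops against `symm8d (coefSide3 |L| S F)` (the target recomputed from the side table in each cell)
⇒ the rowwise domination consumed by `FK.shape3C_nonneg_of_rows`. [folklore] -/
theorem rows_of_side3R {L : List (ι × ι)} {iK jK kK i1 j1 k1 i2 j2 k2 ix iy is : ι} {F : ℕ → Pat3 → Pat3 → ℤ}
    {S : List (List (List (List (Pat3 × ℕ))))} {prods : List Prod3} {Dn B : ℕ} (hB : 2 * L.length + 2 ≤ B)
    (hS : sideCheck3 L iK jK kK i1 j1 k1 i2 j2 k2 ix iy is S = true)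
    (hshift : (prods.all fun p => decide (p.shift ≤ B)) = true) (hsym : prodsSym prods = true)
    (hpairs : ∀ pq ∈ Pat3.pairsLE,
      loop1R (symm8d (coefSide3 L.length S F)) 8 Dn B (prods.filter fun p => suppAt p.gK pq.1 pq.2) pq.1 pq.2 = true)
    (d : ℕ) (PK QK P1 Q1 P2 Q2 : Pat3) :
    8 * (prods.map fun q => (q.lam : ℤ) * q.tensor d PK QK P1 Q1 P2 Q2).sum ≤
      (Dn : ℤ) * symm8d (coefTab3 L iK jK kK i1 j1 k1 i2 j2 k2 ix iy is F) d PK QK P1 Q1 P2 Q2 := by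
  have e : ∀ d' A1 A2 A3 A4 A5 A6, symm8d (coefSide3 L.length S F) d' A1 A2 A3 A4 A5 A6 =
      symm8d (coefTab3 L iK jK kK i1 j1 k1 i2 j2 k2 ix iy is F) d' A1 A2 A3 A4 A5 A6 := fun d' A1 A2 A3 A4 A5 A6 => by
    simp only [symm8d, coefTab3_eq_coefSide3 hS]
  have key := certCheckGR_of_pairs 8 Dn B hshift hsym hpairs (symm8d_swapK _) (symm8d_swap1 _) (symm8d_swap2 _)
    (fun d' hd' A1 A2 A3 A4 A5 A6 => by
      have hz : ∀ B1 B2 B3 B4 B5 B6 : Pat3, coefTab3 L iK jK kK i1 j1 k1 i2 j2 k2 ix iy is F d' B1 B2 B3 B4 B5 B6 = 0 :=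
        fun _ _ _ _ _ _ => coefTab3_eq_zero L iK jK kK i1 j1 k1 i2 j2 k2 ix iy is F (by omega) _ _ _ _ _ _
      rw [e]; simp only [symm8d, hz, add_zero, le_refl]) d PK QK P1 Q1 P2 Q2
  rw [e] at key
  exact_mod_cast key

end RepLoop

end FK

end Summit.CriticalPhenomena.PercolationContinuityZ3.Theorems
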